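import Mathlib
import Literature.Combinatorics.Additive.SumsetsInRootsOfUnityBound

/-!
# Restricted sumsets contained in the roots of unity: Yip's Stepanov bound (free diagonal)

C. H. Yip, *Restricted sumsets in multiplicative subgroups*, Canad. J. Math. (2025),
doi:10.4153/S0008414X24000920 (arXiv:2309.10950), Proposition 3.1, first bullet:

> Let `A ⊆ 𝔽_q` with `|A| = N` odd such that `A +̂ A ⊆ S` (all sums of two DISTINCT elements of `A` lie in the
> subgroup `S = {x : x ^ d = 1}`) while `A + A ⊄ S ∪ {0}` (some diagonal `2a` is neither `0` nor in `S`).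
> Then `N(N − 1)/2 + #{a ∈ A : 2a ∈ S ∪ {0}} ≤ |S|`.

In the paper the subgroup is the group of `d`-th powers of `𝔽_q^×`, of order `(q−1)/d`; here, as in the companion
file `SumsetsInRootsOfUnityBound` (Hanson–Petridis: FULL sumsets), it is cut out by the equation `x ^ d = 1` and the
bound is `≤ d` (over `𝔽_p` with `d ∣ p − 1` the solution set has exactly `d` elements).  The argument is pure algebra;
it is written over an arbitrary field and an arbitrary exponent `d`.  So Stepanov's method with the diagonal cured by
the factor `(X − a)^m` reproduces, for RESTRICTED sumsets and without any Sidon hypothesis, exactly the weak-Sidon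
counting bound `N(N−1)/2 ≤ d`, plus one unit per point whose diagonal is good.  For `d = (p−1)/2` (quadratic residues
by Euler's criterion): a restricted Paley sum-clique of odd size `N` with at least one bad diagonal has
`N(N−1)/2 + #{good diagonals} ≤ (p−1)/2` (`choose_two_add_card_good_le_of_restrictedSumset_subset_quadraticResidues`).

Proof: the paper's (Stepanov's method), written without hyper-derivatives in the style of the companion file —
degree bound `natDegree_stepanovPoly_le`, two-factor Taylor expansion `X_add_C_pow_mul_X_sub_C_pow_eq`, root
multiplicities `X_sub_C_pow_dvd_stepanovPoly`, non-vanishing at a bad point `stepanovPoly_ne_zero`.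

Not done here: the second bullet of Prop. 3.1 (`N` even: `((N−1)² + 1)/2 ≤ d`, via the auxiliary polynomial of `A`
minus a point — only the weaker corollary by deleting a point is derived, `restrictedSumset_subset_rootsOfUnity_even`),
its `0 ∈ A` refinement, Prop. 3.2 (`A +̂ A ⊆ S ∪ {0}`), Theorem 1.6, and prime powers.
-- TODO(general form): Yip, Prop. 3.1 second bullet and Prop. 3.2.
-/

namespace Literature.Combinatorics.Additive.Yip

open Polynomial Finset
open Literature.Combinatorics.Additive.HansonPetridis

section Taylor

variable {F : Type*} [Field F]

/-- **Two-factor Taylor expansion at `b`** [folklore]: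
`(X + a)^D (X − a)^m = Σ_{k ≤ D} Σ_{l ≤ m} C(D,k) (a+b)^{D−k} · C(m,l) (b−a)^{m−l} · (X − b)^{k+l}`. -/
theorem X_add_C_pow_mul_X_sub_C_pow_eq (a b : F) (D m : ℕ) :
    (X + C a) ^ D * (X - C a) ^ m =
      ∑ k ∈ range (D + 1), ∑ l ∈ range (m + 1),
        C ((D.choose k : F) * (a + b) ^ (D - k) * ((m.choose l : F) * (b - a) ^ (m - l))) *
          (X - C b) ^ (k + l) := by
  have h1 : (X + C a : F[X]) = (X - C b) + C (a + b) := by rw [map_add]; ring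
  have h2 : (X - C a : F[X]) = (X - C b) + C (b - a) := by rw [map_sub]; ring
  rw [h1, h2, add_pow, add_pow, Finset.sum_mul_sum]
  refine Finset.sum_congr rfl fun k _ => Finset.sum_congr rfl fun l _ => ?_
  rw [← C_pow, ← C_pow, map_mul, map_mul, map_mul, map_natCast, map_natCast, pow_add]
  ring

/-- `(C c · (X − b)^j) ∘ (X + b) = C c · X^j`, so its `m`-th coefficient is `c · [j = m]` [folklore]. -/
theorem coeff_comp_C_mul_X_sub_C_pow (c b : F) (j m : ℕ) :
    ((C c * (X - C b) ^ j).comp (X + C b)).coeff m = if j = m then c else 0 := by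
  rw [mul_comp, C_comp, pow_comp, sub_comp, X_comp, C_comp, add_sub_cancel_right, coeff_C_mul, coeff_X_pow]
  by_cases h : j = m
  · simp [h]
  · simp [h, Ne.symm h]

end Taylor

section Stepanov

variable {F : Type*} [Field F] [DecidableEq F]

/-! Yip's auxiliary polynomial is `f = Σ_{a ∈ A} w_a (X + a)^D (X − a)^m − (−1)^m` with the Lagrange nodal weights
`w_a = Lagrange.nodalWeight A id a` of `A` [cite: Yip2025, Prop. 3.1]; it is written out in full in every statement
below (no auxiliary definition). -/

/-- The nodal-weight sum of a polynomial of degree `< |A| − 1` evaluated on `A` vanishes [folklore]. -/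
theorem sum_nodalWeight_mul_eval_eq_zero (A : Finset F) (g : F[X]) (hg : g.natDegree + 1 < A.card) :
    ∑ a ∈ A, Lagrange.nodalWeight A id a * g.eval a = 0 := by
  have hdeg : g.degree < A.card :=
    lt_of_le_of_lt degree_le_natDegree (by exact_mod_cast (by omega : g.natDegree < A.card))
  rw [sum_nodalWeight_mul_eval_eq_coeff A g hdeg, coeff_eq_zero_of_natDegree_lt (by omega)]

/-- **Degree bound** `deg f ≤ d`: the top `2m = |A| − 1` coefficients of `Σ_a w_a (X + a)^{d+m} (X − a)^m` vanish by
the Vandermonde identities `Σ_a w_a a^l = 0`, `l < |A| − 1` [cite: Yip2025, Prop. 3.1, proof]. -/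
theorem natDegree_stepanovPoly_le (A : Finset F) (d m : ℕ) (hm : 2 * m + 1 = A.card) :
    ((∑ a ∈ A, C (Lagrange.nodalWeight A id a) * ((X + C a) ^ (d + m) * (X - C a) ^ m)) -
      C ((-1 : F) ^ m)).natDegree ≤ d := by
  refine (natDegree_sub_le _ _).trans (max_le ?_ (by rw [natDegree_C]; exact Nat.zero_le _))
  rw [natDegree_le_iff_coeff_eq_zero]
  intro n hn
  rw [finsetSum_coeff]
  have hXsub : ∀ a : F, (X - C a : F[X]) = X + C (-a) := fun a => by rw [map_neg, sub_eq_add_neg]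
  simp_rw [coeff_C_mul, coeff_mul, hXsub, coeff_X_add_C_pow, Finset.mul_sum]
  rw [Finset.sum_comm]
  refine Finset.sum_eq_zero fun x hx => ?_
  rw [Finset.HasAntidiagonal.mem_antidiagonal] at hx
  by_cases hi : d + m < x.1
  · simp [Nat.choose_eq_zero_of_lt hi]
  by_cases hj : m < x.2
  · simp [Nat.choose_eq_zero_of_lt hj]
  push Not at hi hj
  have hcalc : ∀ a ∈ A, Lagrange.nodalWeight A id a *
      (a ^ (d + m - x.1) * ((d + m).choose x.1 : F) * ((-a) ^ (m - x.2) * (m.choose x.2 : F))) =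
      ((d + m).choose x.1 : F) * (m.choose x.2 : F) * (-1) ^ (m - x.2) *
        (Lagrange.nodalWeight A id a * a ^ ((d + m - x.1) + (m - x.2))) := by
    intro a _
    rw [neg_pow, pow_add]
    ring
  rw [Finset.sum_congr rfl hcalc, ← Finset.mul_sum]
  have hl : (d + m - x.1) + (m - x.2) < A.card := by omega
  rw [sum_nodalWeight_mul_pow A _ hl, if_neg (by omega), mul_zero]

/-- **The weighted Taylor sums below the critical order.**  For `b ∈ F` with `(a + b)^d = 1` for all `a ∈ A ∖ {b}`,
`1 ≤ m`, `2m + 1 = |A|`, and `k + l ≤ m` with `l < m` (or `l = m`, `k = 0` and `2b ∈ S ∪ {0}`), the nodal-weight sum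
`Σ_a w_a (a+b)^{d+m−k} (b−a)^{m−l}` equals `[k = l = 0] · (−1)^m` [cite: Yip2025, Prop. 3.1, claim (eq:claim)]. -/
theorem sum_nodalWeight_taylorTerm (A : Finset F) (d m : ℕ) (hm : 2 * m + 1 = A.card) (hm1 : 1 ≤ m) (b : F)
    (hA : ∀ a ∈ A, a ≠ b → (a + b) ^ d = 1) (k l : ℕ) (hkl : k + l ≤ m)
    (hcase : l < m ∨ (l = m ∧ (2 * b = 0 ∨ (2 * b) ^ d = 1))) :
    ∑ a ∈ A, Lagrange.nodalWeight A id a * ((a + b) ^ (d + m - k) * (b - a) ^ (m - l)) =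
      if k = 0 ∧ l = 0 then (-1) ^ m else 0 := by
  set P : F[X] := (X + C b) ^ (m - k) * (C b - X) ^ (m - l) with hP
  -- replace `(a + b)^{d+m-k}` by `(a + b)^{m-k}` termwise, i.e. by `P.eval a`
  have hterm : ∀ a ∈ A, Lagrange.nodalWeight A id a * ((a + b) ^ (d + m - k) * (b - a) ^ (m - l)) =
      Lagrange.nodalWeight A id a * P.eval a := by
    intro a ha
    rw [hP, eval_mul, eval_pow, eval_pow, eval_add, eval_sub, eval_X, eval_C]
    congr 1
    by_cases hab : a = b
    · subst hab
      rcases hcase with hl | ⟨rfl, hgood⟩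
      · rw [sub_self, zero_pow (by omega), mul_zero, mul_zero]
      · have hk0 : k = 0 := by omega
        subst hk0
        rw [Nat.sub_zero, Nat.sub_zero, ← two_mul]
        congr 1
        rcases hgood with h0 | h1
        · rw [h0, zero_pow (by omega), zero_pow (by omega)]
        · rw [pow_add, h1, one_mul]
    · rw [show d + m - k = d + (m - k) by omega, pow_add, hA a ha hab, one_mul]
  rw [Finset.sum_congr rfl hterm]
  have hdegP : P.natDegree ≤ (m - k) + (m - l) := by
    rw [hP]
    refine (natDegree_mul_le).trans (add_le_add ?_ ?_)
    · calc ((X + C b) ^ (m - k) : F[X]).natDegree ≤ (m - k) * (X + C b : F[X]).natDegree := natDegree_pow_le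
        _ = m - k := by rw [natDegree_X_add_C, mul_one]
    · have h1 : (C b - X : F[X]).natDegree = 1 := by
        rw [show (C b - X : F[X]) = -(X - C b) by ring, natDegree_neg, natDegree_X_sub_C]
      calc ((C b - X) ^ (m - l) : F[X]).natDegree ≤ (m - l) * (C b - X : F[X]).natDegree := natDegree_pow_le
        _ = m - l := by rw [h1, mul_one]
  by_cases h00 : k = 0 ∧ l = 0
  · obtain ⟨rfl, rfl⟩ := h00
    rw [if_pos ⟨rfl, rfl⟩]
    simp only [Nat.sub_zero] at hP hdegP
    have hdeg : P.degree < A.card := by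
      refine lt_of_le_of_lt degree_le_natDegree ?_
      exact_mod_cast (by omega : P.natDegree < A.card)
    rw [sum_nodalWeight_mul_eval_eq_coeff A P hdeg, show A.card - 1 = 2 * m by omega]
    -- `P = (−1)^m (X² − b²)^m` has `X^{2m}`-coefficient `(−1)^m`
    have hPe : P = C ((-1 : F) ^ m) * (X ^ 2 - C (b ^ 2)) ^ m := by
      rw [hP, ← mul_pow]
      have h1 : ((X + C b) * (C b - X) : F[X]) = -(X ^ 2 - C (b ^ 2)) := by rw [map_pow]; ring
      rw [h1, neg_pow, map_pow C (-1 : F) m, map_neg, map_one]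
    have hmon : (X ^ 2 - C (b ^ 2) : F[X]).Monic := monic_X_pow_sub_C _ two_ne_zero
    have hnat : ((X ^ 2 - C (b ^ 2)) ^ m : F[X]).natDegree = 2 * m := by
      rw [hmon.natDegree_pow, natDegree_X_pow_sub_C, mul_comm]
    rw [hPe, coeff_C_mul, ← hnat, (hmon.pow m).coeff_natDegree, mul_one]
  · rw [if_neg h00]
    apply sum_nodalWeight_mul_eval_eq_zero
    omega

/-- The Taylor expansion of `f` at `b`: `f = Σ_{k ≤ D} Σ_{l ≤ m} (C(e_{k,l}) (X − b)^{k+l} − [k = l = 0]·(−1)^m)`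
with `e_{k,l} = C(D,k) C(m,l) Σ_a w_a (a+b)^{D−k} (b−a)^{m−l}` (bookkeeping) [folklore]. -/
theorem stepanovPoly_eq_sum (A : Finset F) (D m : ℕ) (b : F) :
    ((∑ a ∈ A, C (Lagrange.nodalWeight A id a) * ((X + C a) ^ D * (X - C a) ^ m)) - C ((-1 : F) ^ m)) =
      ∑ k ∈ range (D + 1), ∑ l ∈ range (m + 1),
        (C (((D.choose k : F) * (m.choose l : F)) *
            ∑ a ∈ A, Lagrange.nodalWeight A id a * ((a + b) ^ (D - k) * (b - a) ^ (m - l))) *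
          (X - C b) ^ (k + l) - if k = 0 ∧ l = 0 then C ((-1 : F) ^ m) else 0) := by
  simp_rw [Finset.sum_sub_distrib]
  congr 1
  · simp_rw [X_add_C_pow_mul_X_sub_C_pow_eq _ b D m, Finset.mul_sum]
    rw [Finset.sum_comm]
    refine Finset.sum_congr rfl fun k _ => ?_
    rw [Finset.sum_comm]
    refine Finset.sum_congr rfl fun l _ => ?_
    rw [map_sum, Finset.sum_mul]
    refine Finset.sum_congr rfl fun a _ => ?_
    rw [← mul_assoc, ← map_mul]
    congr 2
    ring
  · rw [Finset.sum_eq_single_of_mem 0 (mem_range.mpr (Nat.succ_pos D))]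
    · rw [Finset.sum_eq_single_of_mem 0 (mem_range.mpr (Nat.succ_pos m))]
      · rw [if_pos ⟨rfl, rfl⟩]
      · intro l _ hl
        rw [if_neg (fun h => hl h.2)]
    · intro k _ hk
      exact Finset.sum_eq_zero fun l _ => by rw [if_neg (fun h => hk h.1)]

/-- **Root multiplicities** [cite: Yip2025, Prop. 3.1, proof]: if `(a + b)^d = 1` for all `a ∈ A ∖ {b}` then
`(X − b)^m ∣ f`, and `(X − b)^{m+1} ∣ f` when moreover `2b ∈ S ∪ {0}`. -/
theorem X_sub_C_pow_dvd_stepanovPoly (A : Finset F) (d m : ℕ) (hm : 2 * m + 1 = A.card) (hm1 : 1 ≤ m) (b : F)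
    (hA : ∀ a ∈ A, a ≠ b → (a + b) ^ d = 1) :
    (X - C b) ^ (if 2 * b = 0 ∨ (2 * b) ^ d = 1 then m + 1 else m) ∣
      ((∑ a ∈ A, C (Lagrange.nodalWeight A id a) * ((X + C a) ^ (d + m) * (X - C a) ^ m)) - C ((-1 : F) ^ m)) := by
  set M : ℕ := if 2 * b = 0 ∨ (2 * b) ^ d = 1 then m + 1 else m with hM
  have hMm : m ≤ M ∧ M ≤ m + 1 := by
    simp only [hM]; split_ifs <;> omega
  rw [stepanovPoly_eq_sum A (d + m) m b]
  refine Finset.dvd_sum fun k hk => Finset.dvd_sum fun l hl => ?_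
  rw [mem_range] at hk hl
  by_cases hlow : k + l < M
  · -- low terms vanish identically
    have hkl : k + l ≤ m := by omega
    have hcase : l < m ∨ (l = m ∧ (2 * b = 0 ∨ (2 * b) ^ d = 1)) := by
      by_cases hlm : l < m
      · exact Or.inl hlm
      · right
        refine ⟨by omega, ?_⟩
        by_contra hbad
        have : M = m := by simp only [hM, if_neg hbad]
        omega
    rw [sum_nodalWeight_taylorTerm A d m hm hm1 b hA k l hkl hcase]
    by_cases h00 : k = 0 ∧ l = 0
    · obtain ⟨rfl, rfl⟩ := h00
      rw [if_pos ⟨rfl, rfl⟩, if_pos ⟨rfl, rfl⟩, Nat.choose_zero_right, Nat.choose_zero_right, Nat.cast_one,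
        one_mul, one_mul, add_zero, pow_zero, mul_one, sub_self]
      exact dvd_zero _
    · rw [if_neg h00, if_neg h00, mul_zero, map_zero, zero_mul, sub_zero]
      exact dvd_zero _
  · -- high terms are multiples of `(X - b)^M`
    have h00 : ¬ (k = 0 ∧ l = 0) := fun h => by
      obtain ⟨rfl, rfl⟩ := h
      omega
    rw [if_neg h00, sub_zero]
    exact Dvd.dvd.mul_left (pow_dvd_pow (X - C b) (by omega)) _

/-- **Non-vanishing at a bad point** [cite: Yip2025, Prop. 3.1, proof]: if `b₀ ∈ A` has `2b₀ ≠ 0`, `(2b₀)^d ≠ 1` and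
`(a + b₀)^d = 1` for all `a ∈ A ∖ {b₀}`, then the `(X − b₀)^m`-Taylor coefficient of `f` is
`w_{b₀} (2b₀)^m ((2b₀)^d − 1) ≠ 0`; in particular `f ≠ 0`. -/
theorem stepanovPoly_ne_zero (A : Finset F) (d m : ℕ) (hm : 2 * m + 1 = A.card) (hm1 : 1 ≤ m) (b₀ : F)
    (hb₀ : b₀ ∈ A) (hbad : 2 * b₀ ≠ 0 ∧ (2 * b₀) ^ d ≠ 1) (hA : ∀ a ∈ A, a ≠ b₀ → (a + b₀) ^ d = 1) :
    ((∑ a ∈ A, C (Lagrange.nodalWeight A id a) * ((X + C a) ^ (d + m) * (X - C a) ^ m)) - C ((-1 : F) ^ m)) ≠ 0 := by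
  -- the linear functional `φ g = ((g ∘ (X + b₀)).coeff m` picks out the `(X - b₀)^m`-coefficient
  intro hf
  have hφ : ((((∑ a ∈ A, C (Lagrange.nodalWeight A id a) * ((X + C a) ^ (d + m) * (X - C a) ^ m)) -
      C ((-1 : F) ^ m)).comp (X + C b₀)).coeff m) = 0 := by
    rw [hf, zero_comp, coeff_zero]
  rw [stepanovPoly_eq_sum A (d + m) m b₀] at hφ
  -- push `comp` and `coeff` through the double sum
  have hcomp : ∀ (s : Finset ℕ) (g : ℕ → F[X]),
      (∑ i ∈ s, g i).comp (X + C b₀) = ∑ i ∈ s, (g i).comp (X + C b₀) := by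
    intro s g
    simp only [← Polynomial.coe_compRingHom_apply, map_sum]
  rw [hcomp, finsetSum_coeff] at hφ
  simp_rw [hcomp, finsetSum_coeff, sub_comp, coeff_sub, coeff_comp_C_mul_X_sub_C_pow] at hφ
  -- the constant correction contributes nothing to the `m`-th coefficient (`m ≥ 1`)
  have hconst : ∀ k l : ℕ, ((if k = 0 ∧ l = 0 then C ((-1 : F) ^ m) else 0).comp (X + C b₀)).coeff m = 0 := by
    intro k l
    split_ifs
    · rw [C_comp, coeff_C, if_neg (by omega)]
    · rw [zero_comp, coeff_zero]
  simp_rw [hconst, sub_zero] at hφ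
  -- only the layer `k + l = m` survives; there only `(k, l) = (0, m)` is non-zero
  rw [Finset.sum_eq_single_of_mem 0 (mem_range.mpr (Nat.succ_pos _))] at hφ
  · rw [Finset.sum_eq_single_of_mem m (mem_range.mpr (Nat.lt_succ_self m))] at hφ
    · rw [zero_add, if_pos rfl, Nat.choose_zero_right, Nat.choose_self, Nat.cast_one, one_mul, one_mul,
        Nat.sub_zero, Nat.sub_self] at hφ
      simp_rw [pow_zero, mul_one] at hφ
      -- `Σ_a w_a (a + b₀)^{d+m} = w_{b₀} (2b₀)^m ((2b₀)^d − 1)`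
      have hsplit : ∀ a ∈ A, Lagrange.nodalWeight A id a * (a + b₀) ^ (d + m) =
          Lagrange.nodalWeight A id a * (a + b₀) ^ m +
            (if a = b₀ then Lagrange.nodalWeight A id b₀ * ((2 * b₀) ^ m * ((2 * b₀) ^ d - 1)) else 0) := by
        intro a ha
        by_cases hab : a = b₀
        · subst hab
          rw [if_pos rfl, ← two_mul, pow_add]
          ring
        · rw [if_neg hab, add_zero, pow_add, hA a ha hab, one_mul]
      rw [Finset.sum_congr rfl hsplit, Finset.sum_add_distrib, Finset.sum_ite_eq' A b₀, if_pos hb₀,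
        sum_nodalWeight_mul_add_pow A b₀ m (by omega), if_neg (by omega), zero_add] at hφ
      have hw : Lagrange.nodalWeight A id b₀ ≠ 0 := Lagrange.nodalWeight_ne_zero (Set.injOn_id _) hb₀
      have h2 : (2 * b₀) ^ m ≠ 0 := pow_ne_zero _ hbad.1
      have h3 : (2 * b₀) ^ d - 1 ≠ 0 := sub_ne_zero.mpr hbad.2
      exact (mul_ne_zero hw (mul_ne_zero h2 h3)) hφ
    · intro l hl hlm
      rw [zero_add, if_neg hlm]
  · intro k hk hk0
    refine Finset.sum_eq_zero fun l hl => ?_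
    rw [mem_range] at hk hl
    by_cases hklm : k + l = m
    · rw [if_pos hklm]
      have hlm : l < m := by omega
      rw [sum_nodalWeight_taylorTerm A d m hm hm1 b₀ hA k l hklm.le (Or.inl hlm), if_neg (fun h => hk0 h.1),
        mul_zero]
    · rw [if_neg hklm]

end Stepanov

section Main

variable {F : Type*} [Field F] [DecidableEq F]

/-- **Yip, Proposition 3.1 (first bullet), over any field** [cite: Yip2025, Prop. 3.1].  Let `A` be a finite subset of
a field with `|A|` odd, and `d : ℕ`.  Suppose `(a + a')^d = 1` for all `a ≠ a'` in `A` (restricted sumset inside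
`S = {x : x^d = 1}`), and that some `b₀ ∈ A` has `2b₀ ≠ 0` and `(2b₀)^d ≠ 1` (`A + A ⊄ S ∪ {0}`).  Then
`|A|(|A| − 1)/2 + #{a ∈ A : 2a = 0 ∨ (2a)^d = 1} ≤ d`. -/
theorem choose_two_add_card_good_le_of_restrictedSumset_subset_rootsOfUnity (d : ℕ) (A : Finset F)
    (hA : ∀ a ∈ A, ∀ a' ∈ A, a ≠ a' → (a + a') ^ d = 1) (hodd : Odd A.card)
    (hbad : ∃ b₀ ∈ A, 2 * b₀ ≠ 0 ∧ (2 * b₀) ^ d ≠ 1) :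
    A.card * (A.card - 1) / 2 + (A.filter fun a => 2 * a = 0 ∨ (2 * a) ^ d = 1).card ≤ d := by
  obtain ⟨b₀, hb₀, hbad⟩ := hbad
  obtain ⟨m, hm'⟩ := hodd
  have hm : 2 * m + 1 = A.card := hm'.symm
  -- `d ≥ 1` (else `(2b₀)^0 = 1`)
  have hd1 : 1 ≤ d := by
    rcases Nat.eq_zero_or_pos d with h | h
    · exact absurd (by rw [h, pow_zero]) hbad.2
    · exact h
  rcases Nat.eq_zero_or_pos m with hm0 | hm1
  · -- `|A| = 1`, `A = {b₀}` with a bad diagonal: both terms vanish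
    subst hm0
    have hA1 : A.card = 1 := by omega
    obtain ⟨x, hx⟩ := Finset.card_eq_one.mp hA1
    have hxb : x = b₀ := by rw [hx, mem_singleton] at hb₀; exact hb₀.symm
    subst hxb
    rw [hA1, hx]
    have : (({x} : Finset F).filter fun a => 2 * a = 0 ∨ (2 * a) ^ d = 1) = ∅ := by
      rw [Finset.filter_singleton, if_neg (not_or.mpr ⟨hbad.1, hbad.2⟩)]
    rw [this, card_empty]
    omega
  · set f : F[X] := ((∑ a ∈ A, C (Lagrange.nodalWeight A id a) * ((X + C a) ^ (d + m) * (X - C a) ^ m)) -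
      C ((-1 : F) ^ m)) with hf
    have hdeg : f.natDegree ≤ d := natDegree_stepanovPoly_le A d m hm
    have hf0 : f ≠ 0 :=
      stepanovPoly_ne_zero A d m hm hm1 b₀ hb₀ hbad fun a ha hab => hA a ha b₀ hb₀ hab
    set mult : F → ℕ := fun b => if 2 * b = 0 ∨ (2 * b) ^ d = 1 then m + 1 else m with hmult
    have hroot : ∀ b ∈ A, (X - C b) ^ mult b ∣ f := fun b hb =>
      X_sub_C_pow_dvd_stepanovPoly A d m hm hm1 b fun a ha hab => hA a ha b hb hab
    have hprod : (∏ b ∈ A, (X - C b) ^ mult b) ∣ f := by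
      refine Finset.prod_dvd_of_coprime ?_ hroot
      intro b _ b' _ hbb'
      exact (pairwise_coprime_X_sub_C (K := F) Function.injective_id hbb').pow
    have hsum : ∑ b ∈ A, mult b ≤ d := by
      have h1 : (∏ b ∈ A, (X - C b) ^ mult b).natDegree = ∑ b ∈ A, mult b := by
        rw [natDegree_prod_of_monic _ _ fun b _ => (monic_X_sub_C b).pow (mult b)]
        refine Finset.sum_congr rfl fun b _ => ?_
        rw [(monic_X_sub_C b).natDegree_pow, natDegree_X_sub_C, mul_one]
      rw [← h1]
      exact (natDegree_le_of_dvd hprod hf0).trans hdeg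
    -- bookkeeping: `Σ_b mult b = m |A| + #good = |A|(|A|−1)/2 + #good`
    have hbook : ∑ b ∈ A, mult b = m * A.card + (A.filter fun a => 2 * a = 0 ∨ (2 * a) ^ d = 1).card := by
      rw [Finset.card_filter, Finset.card_eq_sum_ones A, Finset.mul_sum, ← Finset.sum_add_distrib]
      refine Finset.sum_congr rfl fun b _ => ?_
      simp only [hmult, mul_one]
      split_ifs <;> omega
    have hchoose : A.card * (A.card - 1) / 2 = m * A.card := by
      rw [← hm, Nat.add_sub_cancel, show (2 * m + 1) * (2 * m) = (m * (2 * m + 1)) * 2 by ring,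
        Nat.mul_div_cancel _ two_pos]
    rw [hchoose, ← hbook]
    exact hsum

/-- **Even size, by deleting a point** (a weaker form of [cite: Yip2025, Prop. 3.1, second bullet]): under the same
hypotheses with `|A|` even, `(|A| − 1)(|A| − 2)/2 + #{a ∈ A : 2a = 0 ∨ (2a)^d = 1} ≤ d + 1`. -/
theorem restrictedSumset_subset_rootsOfUnity_even (d : ℕ) (A : Finset F)
    (hA : ∀ a ∈ A, ∀ a' ∈ A, a ≠ a' → (a + a') ^ d = 1) (heven : Even A.card)
    (hbad : ∃ b₀ ∈ A, 2 * b₀ ≠ 0 ∧ (2 * b₀) ^ d ≠ 1) :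
    (A.card - 1) * (A.card - 2) / 2 + (A.filter fun a => 2 * a = 0 ∨ (2 * a) ^ d = 1).card ≤ d + 1 := by
  obtain ⟨b₀, hb₀, hbad⟩ := hbad
  have hcard : 2 ≤ A.card := by
    obtain ⟨r, hr⟩ := heven
    have : 0 < A.card := Finset.card_pos.mpr ⟨b₀, hb₀⟩
    omega
  -- delete a point other than `b₀`
  obtain ⟨x, hx, hxb⟩ : ∃ x ∈ A, x ≠ b₀ := by
    by_contra h
    push Not at h
    have : A ⊆ {b₀} := fun y hy => mem_singleton.mpr (h y hy)
    have := card_le_card this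
    rw [card_singleton] at this
    omega
  set A' := A.erase x with hA'
  have hb₀' : b₀ ∈ A' := mem_erase.mpr ⟨hxb.symm, hb₀⟩
  have hcard' : A'.card = A.card - 1 := card_erase_of_mem hx
  have hodd' : Odd A'.card := by
    rw [hcard']
    obtain ⟨r, hr⟩ := heven
    exact ⟨r - 1, by omega⟩
  have hA'' : ∀ a ∈ A', ∀ a' ∈ A', a ≠ a' → (a + a') ^ d = 1 :=
    fun a ha a' ha' h => hA a (mem_of_mem_erase ha) a' (mem_of_mem_erase ha') h
  have h := choose_two_add_card_good_le_of_restrictedSumset_subset_rootsOfUnity d A' hA'' hodd'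
    ⟨b₀, hb₀', hbad⟩
  rw [hcard'] at h
  have hfilter : (A.filter fun a => 2 * a = 0 ∨ (2 * a) ^ d = 1).card ≤
      (A'.filter fun a => 2 * a = 0 ∨ (2 * a) ^ d = 1).card + 1 := by
    rw [hA', Finset.filter_erase]
    have := Finset.pred_card_le_card_erase (s := A.filter fun a => 2 * a = 0 ∨ (2 * a) ^ d = 1) (a := x)
    omega
  rw [show A.card - 1 - 1 = A.card - 2 by omega] at h
  set T := (A.card - 1) * (A.card - 2) / 2
  omega

/-- **Quadratic residues** (`d = (p−1)/2`, membership by Euler's criterion `x ^ (p/2) = 1`)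
[cite: Yip2025, Prop. 3.1]: a restricted Paley sum-clique `Q ⊆ 𝔽_p` of ODD size — `(a + b)^{(p−1)/2} = 1` for all
`a ≠ b` in `Q` — with at least one bad diagonal (`2b₀ ≠ 0`, `(2b₀)^{(p−1)/2} ≠ 1`) satisfies
`|Q|(|Q|−1)/2 + #{a ∈ Q : 2a = 0 ∨ (2a)^{(p−1)/2} = 1} ≤ (p−1)/2`: Stepanov's method recovers the weak-Sidon counting
bound without the Sidon hypothesis, plus one unit per good diagonal. -/
theorem choose_two_add_card_good_le_of_restrictedSumset_subset_quadraticResidues {p : ℕ} [Fact p.Prime]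
    (Q : Finset (ZMod p)) (hQ : ∀ a ∈ Q, ∀ b ∈ Q, a ≠ b → (a + b) ^ (p / 2) = 1) (hodd : Odd Q.card)
    (hbad : ∃ b₀ ∈ Q, 2 * b₀ ≠ 0 ∧ (2 * b₀) ^ (p / 2) ≠ 1) :
    Q.card * (Q.card - 1) / 2 + (Q.filter fun a => 2 * a = 0 ∨ (2 * a) ^ (p / 2) = 1).card ≤ p / 2 :=
  choose_two_add_card_good_le_of_restrictedSumset_subset_rootsOfUnity (p / 2) Q hQ hodd hbad

end Main

end Literature.Combinatorics.Additive.Yip
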